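import Literature.Geometry.Lorentzian.KerrTimeDerivative
import HarnessLib

/-!
# Data of admissible Kerr waves: ALL derivatives vanish at data-free slice points; the initial
# coordinate Sobolev energy of every order is finite

(family `gr`, infrastructure for **gr.S24** and for the `κ`-explicit programme near extremality;
namespaces `Literature.Geometry.Lorentzian`, `Literature.Geometry.Lorentzian.Kerr`)

`KerrTimeDerivative.lean` proves that for a smooth solution `ψ` of `□_g ψ = 0` on a Kerr–Schild chart
domain whose data `(ψ, dψ)` vanish at the points of the slice `{t* = 0}` outside a compact set `K`,
all SECOND derivatives `D²ψ̃` vanish at those points (`Kerr.fderiv_fderiv_extend_eq_zero_of_data`),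
whence `Tψ` is admissible with the same `K` and the second-order energy of the data is finite
(`IsAdmissibleKerrWave.sliceSobolevEnergy_two_lt_top`). Dafermos–Rodnianski–Shlapentokh-Rothman's
higher-order statement (arXiv:1402.7034, Thm. 3.2 (25) at order `j`) has the order-`j` energy of the
data on its right-hand side, and its consequence forms ("`E < ∞` for smooth compactly supported
data", §4.1) need that energy to be finite at EVERY order. This file supplies it:

* `iteratedFDeriv_succ_basis_cons` — `D^{n+1}f(x)(e_μ, e_w) = ∂_μ (y ↦ D^n f(y)(e_w))(x)` for `f`
  smooth at `x` (Mathlib's `DifferentiableAt.iteratedFDeriv_succ_apply_left'` on basis tuples);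
* `iteratedFDeriv_basis_cons_zero` — **the time slot moves inside**: for `f` smooth on an open set
  `U ∋ x`, `D^{n+1}f(x)(e₀, e_w) = D^n(∂₀f)(x)(e_w)` (induction on `n`; only the symmetry of SECOND
  derivatives, `fderiv_fderiv_apply_comm`, is used);
* `Kerr.timeDeriv_data_eq_zero_of_data` — the data of `Tψ` vanish off the same `K` (the content of
  `IsAdmissibleKerrWave.timeDeriv`, with the support set explicit);
* `Kerr.iteratedFDeriv_extend_basis_eq_zero_of_data`, `Kerr.iteratedFDeriv_extend_eq_zero_of_data` —
  **all iterated derivatives `D^nψ̃(x)` vanish at data-free slice points** `x ∉ K`: on basis tuples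
  `(e_{w₀}, …, e_{w_{n−1}})` by induction on `n` — a spatial outermost direction differentiates the
  function `y ↦ D^{n−1}ψ̃(y)(…)`, which vanishes at the nearby slice points (induction hypothesis),
  along a line inside the slice; the time direction is moved inside and `∂₀ψ̃ = (Tψ)~` near `x`, to
  which the induction hypothesis applies (`Tψ` solves the equation, `Kerr.dalembertian_timeDeriv_eq_zero`,
  with data vanishing off the same `K`); then multilinearity (`Module.Basis.ext_multilinear`);
* `IsAdmissibleKerrWave.sliceSobolevEnergy_lt_top` — **`E_k[ψ](0) = sliceSobolevEnergy … ψ 0 k 0 univ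
  < ∞` for every admissible wave and every `k`** (the integrand is continuous on `K` and vanishes
  off `K`).

## References

* M. Dafermos, I. Rodnianski, Y. Shlapentokh-Rothman, *Decay for solutions of the wave equation on
  Kerr exterior spacetimes III: the full subextremal case `|a| < M`*, Ann. of Math. 183 (2016)
  787–913, arXiv:1402.7034, §2.2.2 (`T` Killing), §3.2 Thm. 3.2 (25) (order-`j` data energy), §4.1
  (reduction to smooth compactly supported data) (key `DafermosRodnianskiShlapentokhrothman2014`).
-/

noncomputable section

open Set Filter
open scoped Topology Manifold ContDiff

namespace Literature.Geometry.Lorentzian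

/-! ### Iterated derivatives on coordinate basis tuples -/

/-- **Outermost slot**: `D^{n+1}f(x)(e_μ, e_{w}) = ∂_{e_μ}(y ↦ D^n f(y)(e_w))(x)` for `f` smooth at
`x`. [folklore] -/
theorem iteratedFDeriv_succ_basis_cons {f : E4 → ℝ} {x : E4} (hf : ContDiffAt ℝ ∞ f x) (n : ℕ)
    (μ : Fin 4) (w : Fin n → Fin 4) :
    iteratedFDeriv ℝ (n + 1) f x (Fin.cons (E4.basisVector μ) fun i ↦ E4.basisVector (w i)) =
      fderiv ℝ (fun y ↦ iteratedFDeriv ℝ n f y fun i ↦ E4.basisVector (w i)) x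
        (E4.basisVector μ) := by
  have hfn : ContDiffAt ℝ ((n + 1 : ℕ) : ℕ∞) f x := hf.of_le (by exact_mod_cast le_top)
  have hd : DifferentiableAt ℝ (iteratedFDeriv ℝ n f) x :=
    hfn.differentiableAt_iteratedFDeriv (by exact_mod_cast (by omega : n < n + 1))
  rw [hd.iteratedFDeriv_succ_apply_left']
  simp only [Fin.cons_zero, Fin.tail_cons]

/-- The basis tuple of a word is the `Fin.cons` of its head vector and the tuple of its tail.
[folklore] -/
theorem basisTuple_eq_cons {n : ℕ} (w : Fin (n + 1) → Fin 4) :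
    (fun i ↦ E4.basisVector (w i)) =
      Fin.cons (E4.basisVector (w 0)) fun i ↦ E4.basisVector (Fin.tail w i) := by
  funext i
  refine Fin.cases ?_ (fun j ↦ ?_) i
  · simp
  · simp [Fin.tail]

/-- `y ↦ D^n f(y)(m)` is `C^k` at `x` if `f` is smooth at `x`. [folklore] -/
theorem contDiffAt_iteratedFDeriv_apply {f : E4 → ℝ} {x : E4} (hf : ContDiffAt ℝ ∞ f x) (n : ℕ)
    (m : Fin n → E4) (k : ℕ) :
    ContDiffAt ℝ k (fun y ↦ iteratedFDeriv ℝ n f y m) x := by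
  have hfn : ContDiffAt ℝ ((k + n : ℕ) : ℕ∞) f x := hf.of_le (by exact_mod_cast le_top)
  have h1 : ContDiffAt ℝ k (iteratedFDeriv ℝ n f) x :=
    hfn.iteratedFDeriv_right (by push_cast; exact le_rfl)
  exact ((ContinuousMultilinearMap.apply ℝ (fun _ : Fin n ↦ E4) ℝ m).contDiff.of_le le_top).contDiffAt.comp
    x h1

/-- **The time slot moves inside.** For `f` smooth on an open set `U` and `x ∈ U`:
`D^{n+1}f(x)(e₀, e_w) = D^n(∂₀f)(x)(e_w)`, `∂₀f = (y ↦ Df(y)e₀)`. Induction on `n`, using only the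
symmetry of second derivatives (`fderiv_fderiv_apply_comm`) applied to the smooth functions
`y ↦ D^n f(y)(e_{w'})`. [folklore] -/
theorem iteratedFDeriv_basis_cons_zero {U : Set E4} (hU : IsOpen U) :
    ∀ (n : ℕ) (f : E4 → ℝ), (∀ y ∈ U, ContDiffAt ℝ ∞ f y) → ∀ x ∈ U, ∀ w : Fin n → Fin 4,
      iteratedFDeriv ℝ (n + 1) f x (Fin.cons (E4.basisVector 0) fun i ↦ E4.basisVector (w i)) =
        iteratedFDeriv ℝ n (fun y ↦ fderiv ℝ f y (E4.basisVector 0)) x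
          fun i ↦ E4.basisVector (w i) := by
  intro n
  induction n with
  | zero =>
    intro f hf x hx w
    rw [iteratedFDeriv_succ_basis_cons (hf x hx), iteratedFDeriv_zero_apply]
    simp only [iteratedFDeriv_zero_apply]
  | succ n ih =>
    intro f hf x hx w
    have hfx : ContDiffAt ℝ ∞ f x := hf x hx
    -- the partial derivative `∂₀ f` is smooth on `U`
    have hf0 : ∀ y ∈ U, ContDiffAt ℝ ∞ (fun y ↦ fderiv ℝ f y (E4.basisVector 0)) y := fun y hy ↦
      contDiffAt_fderiv_apply_const_infty (hf y hy) _
    set w' : Fin n → Fin 4 := Fin.tail w with hw'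
    set G : E4 → ℝ := fun z ↦ iteratedFDeriv ℝ n f z fun i ↦ E4.basisVector (w' i) with hG
    have hG2 : ContDiffAt ℝ 2 G x := contDiffAt_iteratedFDeriv_apply hfx n _ 2
    -- (1) outermost slot `e₀`, then the word `w = w 0 :: w'`
    rw [iteratedFDeriv_succ_basis_cons hfx (n + 1) 0 w]
    have h1 : (fun y ↦ iteratedFDeriv ℝ (n + 1) f y fun i ↦ E4.basisVector (w i)) =ᶠ[𝓝 x]
        fun y ↦ fderiv ℝ G y (E4.basisVector (w 0)) := by
      filter_upwards [hU.mem_nhds hx] with y hy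
      rw [basisTuple_eq_cons w, iteratedFDeriv_succ_basis_cons (hf y hy) n (w 0) w']
    rw [h1.fderiv_eq]
    -- (2) commute `∂₀` and `∂_{w 0}` on the `C²` function `G`
    rw [fderiv_fderiv_apply_comm hG2]
    -- (3) `∂₀ G = D^{n+1} f (e₀, e_{w'}) = D^n (∂₀ f)(e_{w'})` near `x`
    have h3 : (fun y ↦ fderiv ℝ G y (E4.basisVector 0)) =ᶠ[𝓝 x]
        fun y ↦ iteratedFDeriv ℝ n (fun z ↦ fderiv ℝ f z (E4.basisVector 0)) y
          fun i ↦ E4.basisVector (w' i) := by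
      filter_upwards [hU.mem_nhds hx] with y hy
      rw [hG, ← iteratedFDeriv_succ_basis_cons (hf y hy) n 0 w', ih f hf y hy w']
    rw [h3.fderiv_eq, ← iteratedFDeriv_succ_basis_cons (hf0 x hx) n (w 0) w', ← basisTuple_eq_cons w]

/-- **Iterated derivatives vanish on basis tuples once they vanish on all of them** (multilinearity,
`Module.Basis.ext_multilinear` for the standard basis of `E4`). [folklore] -/
theorem continuousMultilinearMap_eq_zero_of_basis {n : ℕ} (L : E4 [×n]→L[ℝ] ℝ)
    (h : ∀ w : Fin n → Fin 4, L (fun i ↦ E4.basisVector (w i)) = 0) : L = 0 := by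
  apply ContinuousMultilinearMap.toMultilinearMap_injective
  rw [ContinuousMultilinearMap.toMultilinearMap_zero]
  refine Module.Basis.ext_multilinear (fun _ : Fin n ↦ (EuclideanSpace.basisFun (Fin 4) ℝ).toBasis)
    fun w ↦ ?_
  rw [zero_apply, ContinuousMultilinearMap.coe_coe]
  simpa only [OrthonormalBasis.coe_toBasis, EuclideanSpace.basisFun_apply] using h w

end Literature.Geometry.Lorentzian

namespace Literature.Geometry.Lorentzian.Kerr

/-! ### Data of `Tψ` with the support set explicit -/

/-- **The data of `Tψ` vanish off the same compact set** (`M ≥ 0`): at a slice point `x ∉ K`,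
`(Tψ)(x) = ∂₀ψ̃(x) = 0` and `d(Tψ)(x) = D²ψ̃(x)(·, e₀) = 0` (`fderiv_fderiv_extend_eq_zero_of_data`).
This is `IsAdmissibleKerrWave.timeDeriv` with the support set kept.
[cite: DafermosRodnianskiShlapentokhrothman2014, §2.2.2; §4.1] -/
theorem timeDeriv_data_eq_zero_of_data [Facts] [SliceFacts] {M : ℝ} (hM : 0 ≤ M) (a r₀ : ℝ)
    {ψ : region a r₀ → ℝ} (hψ : ContMDiff 𝓘(ℝ, E4) 𝓘(ℝ, ℝ) ∞ ψ)
    (hsol : ∀ x, (smoothMetric M a r₀).toPseudoRiemannianMetric.dalembertian ψ x = 0)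
    {K : Set (region a r₀)} (hK : IsCompact K)
    (hdata : ∀ x : region a r₀, (x : E4) 0 = 0 → x ∉ K →
      ψ x = 0 ∧ mfderiv 𝓘(ℝ, E4) 𝓘(ℝ, ℝ) ψ x = 0)
    (x : region a r₀) (hx0 : (x : E4) 0 = 0) (hxK : x ∉ K) :
    Literature.Geometry.Lorentzian.timeDeriv ψ x = 0 ∧
      mfderiv 𝓘(ℝ, E4) 𝓘(ℝ, ℝ) (Literature.Geometry.Lorentzian.timeDeriv ψ) x = 0 := by
  set Φ : E4 → ℝ := Function.extend Subtype.val ψ 0 with hΦ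
  have hdΦ : fderiv ℝ Φ x = 0 := fderiv_extend_eq_zero (by simp) hψ x (hdata x hx0 hxK).2
  have hΦ2 : ContDiffAt ℝ 2 Φ x := (contDiffAt_extend hψ x).of_le (by norm_cast)
  refine ⟨by simp [Literature.Geometry.Lorentzian.timeDeriv, ← hΦ, hdΦ], ?_⟩
  have hdiff : DifferentiableAt ℝ (fun y ↦ fderiv ℝ Φ y (E4.basisVector 0)) x :=
    (contDiffAt_fderiv_apply_const (n := 1) (by exact_mod_cast hΦ2) _).differentiableAt
      one_ne_zero
  have hD2 : fderiv ℝ (fderiv ℝ Φ) x = 0 :=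
    fderiv_fderiv_extend_eq_zero_of_data hM a _ hψ hsol hK hdata hx0 hxK
  have hzero : fderiv ℝ (fun y ↦ fderiv ℝ Φ y (E4.basisVector 0)) x = 0 := by
    rw [fderiv_partial_eq_flip hΦ2, hD2]
    simp
  rw [OpensChart.mfderiv_eq x (Literature.Geometry.Lorentzian.timeDeriv ψ) _ (timeDeriv_rep ψ)
    hdiff]
  exact hzero

/-! ### All derivatives vanish at data-free slice points -/

/-- **All iterated derivatives vanish on basis tuples at data-free slice points.** For a smooth
solution of `□_g ψ = 0` (`M ≥ 0`) on a chart domain whose data vanish on `{t* = 0}` outside a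
compact `K`: `D^nψ̃(x)(e_{w₀}, …, e_{w_{n−1}}) = 0` at every slice point `x ∉ K`, for every `n` and
every word `w`. Induction on `n` simultaneously for all such `ψ`: a spatial outermost direction
`e_{w₀}` differentiates `y ↦ D^{n−1}ψ̃(y)(…)` along a line inside the slice, on which it vanishes
near `x` (hypothesis at the nearby data-free slice points); the time direction is moved inside
(`iteratedFDeriv_basis_cons_zero`) and `∂₀ψ̃ = (Tψ)~` near `x`, where `Tψ` is again such a solution
with the same `K` (`dalembertian_timeDeriv_eq_zero`, `timeDeriv_data_eq_zero_of_data`).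
[cite: DafermosRodnianskiShlapentokhrothman2014, §4.1] -/
theorem iteratedFDeriv_extend_basis_eq_zero_of_data [Facts] [SliceFacts] {M : ℝ} (hM : 0 ≤ M)
    (a r₀ : ℝ) :
    ∀ (n : ℕ) {ψ : region a r₀ → ℝ}, ContMDiff 𝓘(ℝ, E4) 𝓘(ℝ, ℝ) ∞ ψ →
      (∀ x, (smoothMetric M a r₀).toPseudoRiemannianMetric.dalembertian ψ x = 0) →
      ∀ {K : Set (region a r₀)}, IsCompact K →
      (∀ x : region a r₀, (x : E4) 0 = 0 → x ∉ K → ψ x = 0 ∧ mfderiv 𝓘(ℝ, E4) 𝓘(ℝ, ℝ) ψ x = 0) →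
      ∀ x : region a r₀, (x : E4) 0 = 0 → x ∉ K → ∀ w : Fin n → Fin 4,
        iteratedFDeriv ℝ n (Function.extend Subtype.val ψ 0) x (fun i ↦ E4.basisVector (w i)) = 0 := by
  intro n
  induction n with
  | zero =>
    intro ψ hψ hsol K hK hdata x hx0 hxK w
    rw [iteratedFDeriv_zero_apply, ← extend_rep ψ x]
    exact (hdata x hx0 hxK).1
  | succ n ih =>
    intro ψ hψ hsol K hK hdata x hx0 hxK w
    set Φ : E4 → ℝ := Function.extend Subtype.val ψ 0 with hΦ
    have hsmooth : ∀ y ∈ (region a r₀ : Set E4), ContDiffAt ℝ ∞ Φ y := fun y hy ↦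
      contDiffAt_extend hψ ⟨y, hy⟩
    rw [basisTuple_eq_cons w]
    by_cases hμ : w 0 = 0
    · -- the time direction: move it inside and pass to `Tψ`
      rw [hμ, iteratedFDeriv_basis_cons_zero (region a r₀).isOpen n Φ hsmooth x x.2 (Fin.tail w)]
      have hT : (fun y ↦ fderiv ℝ Φ y (E4.basisVector 0)) =ᶠ[𝓝 (x : E4)]
          Function.extend Subtype.val (Literature.Geometry.Lorentzian.timeDeriv ψ) 0 :=
        (extend_timeDeriv_eventuallyEq ψ x).symm
      rw [(hT.iteratedFDeriv ℝ n).eq_of_nhds]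
      exact ih (contMDiff_timeDeriv hψ) (dalembertian_timeDeriv_eq_zero M a r₀ hψ hsol) hK
        (timeDeriv_data_eq_zero_of_data hM a r₀ hψ hsol hK hdata) x hx0 hxK (Fin.tail w)
    · -- a spatial direction: differentiate along a line inside the slice
      rw [iteratedFDeriv_succ_basis_cons (hsmooth x x.2) n (w 0) (Fin.tail w)]
      refine fderiv_apply_eq_zero_of_eventually_eq_zero ?_ ?_
      · exact (contDiffAt_iteratedFDeriv_apply (hsmooth x x.2) n _ 1).differentiableAt one_ne_zero
      · -- nearby points of the line are data-free slice points of the chart domain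
        have hv : (E4.basisVector (w 0) : E4) 0 = 0 := by
          simp [E4.basisVector, Ne.symm hμ]
        have hKc : IsClosed (Subtype.val '' K : Set E4) :=
          (hK.image continuous_subtype_val).isClosed
        have hO : IsOpen ((region a r₀ : Set E4) ∩ (Subtype.val '' K)ᶜ) :=
          (region a r₀).isOpen.inter hKc.isOpen_compl
        have hxO : (x : E4) ∈ (region a r₀ : Set E4) ∩ (Subtype.val '' K)ᶜ := by
          refine ⟨x.2, fun ⟨z, hz, hzx⟩ ↦ hxK ?_⟩
          rwa [← Subtype.ext hzx]
        have hc : Continuous fun s : ℝ ↦ (x : E4) + s • (E4.basisVector (w 0) : E4) := by fun_prop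
        have hev : ∀ᶠ s in 𝓝 (0 : ℝ), (x : E4) + s • (E4.basisVector (w 0) : E4) ∈
            (region a r₀ : Set E4) ∩ (Subtype.val '' K)ᶜ :=
          hc.continuousAt.eventually_mem (hO.mem_nhds (by simpa using hxO))
        filter_upwards [hev] with s hs
        set z : region a r₀ := ⟨(x : E4) + s • (E4.basisVector (w 0) : E4), hs.1⟩ with hz
        have hzK : z ∉ K := fun h ↦ hs.2 ⟨z, h, rfl⟩
        have hz0 : (z : E4) 0 = 0 := by
          have : ((x : E4) + s • (E4.basisVector (w 0) : E4)) 0 = 0 := by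
            rw [PiLp.add_apply, PiLp.smul_apply, hv, hx0, smul_zero, add_zero]
          simpa [hz] using this
        exact ih hψ hsol hK hdata z hz0 hzK (Fin.tail w)

/-- **All iterated derivatives `D^nψ̃(x)` vanish at data-free slice points** (from the basis-tuple
statement by multilinearity). In particular the data of all the commuted and differentiated fields
vanish there, and every coordinate Sobolev integrand of the data is supported in `K`.
[cite: DafermosRodnianskiShlapentokhrothman2014, §4.1] -/
theorem iteratedFDeriv_extend_eq_zero_of_data [Facts] [SliceFacts] {M : ℝ} (hM : 0 ≤ M) (a r₀ : ℝ)
    {ψ : region a r₀ → ℝ} (hψ : ContMDiff 𝓘(ℝ, E4) 𝓘(ℝ, ℝ) ∞ ψ)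
    (hsol : ∀ x, (smoothMetric M a r₀).toPseudoRiemannianMetric.dalembertian ψ x = 0)
    {K : Set (region a r₀)} (hK : IsCompact K)
    (hdata : ∀ x : region a r₀, (x : E4) 0 = 0 → x ∉ K →
      ψ x = 0 ∧ mfderiv 𝓘(ℝ, E4) 𝓘(ℝ, ℝ) ψ x = 0)
    {x : region a r₀} (hx0 : (x : E4) 0 = 0) (hxK : x ∉ K) (n : ℕ) :
    iteratedFDeriv ℝ n (Function.extend Subtype.val ψ 0) x = 0 :=
  continuousMultilinearMap_eq_zero_of_basis _ fun w ↦
    iteratedFDeriv_extend_basis_eq_zero_of_data hM a r₀ n hψ hsol hK hdata x hx0 hxK w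

end Literature.Geometry.Lorentzian.Kerr

namespace Literature.Geometry.Lorentzian

open MeasureTheory
open scoped ENNReal

/-! ### Finiteness of the initial coordinate Sobolev energy of every order -/

/-- **The order-`k` coordinate energy of the data of an admissible wave is finite** (`M ≥ 0`), for
EVERY `k`: on the slice `{t* = 0}` the integrand `∑_{m ≤ k} ‖D^m ψ̃‖²` of
`sliceSobolevEnergy … ψ 0 k 0 univ` is continuous on the compact support set `K` of the data and
vanishes outside it (`Kerr.iteratedFDeriv_extend_eq_zero_of_data`), so the energy is at most
`(sup_K ∑ ‖D^m ψ̃‖²) · vol(B_ρ)` with `K ⊆ {‖y‖ ≤ ρ}`. This is the finiteness "`E < ∞` for smooth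
compactly supported data" of the order-`j` data energy in the consequence forms of DRSR's Thm. 3.2
(arXiv:1402.7034, (25), §4.1); `k = 2` is `IsAdmissibleKerrWave.sliceSobolevEnergy_two_lt_top`.
[cite: DafermosRodnianskiShlapentokhrothman2014, §4.1; Thm. 3.2 (25)] -/
theorem IsAdmissibleKerrWave.sliceSobolevEnergy_lt_top [Kerr.Facts] [Kerr.SliceFacts]
    {M a : ℝ} (hM : 0 ≤ M) {ψ : Kerr.region a (Kerr.rPlus M a) → ℝ}
    (hψ : IsAdmissibleKerrWave M a ψ) (k : ℕ) :
    sliceSobolevEnergy (Kerr.exterior M a) ψ 0 k 0 univ < ⊤ := by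
  obtain ⟨hsmooth, hsol, K, hK, hdata⟩ := hψ
  set Φ : E4 → ℝ := Function.extend Subtype.val ψ 0 with hΦ
  set S : E4 → ℝ := fun x ↦ ∑ m ∈ Finset.range (k + 1), ‖iteratedFDeriv ℝ m Φ x‖ ^ 2 with hS
  -- `S` is continuous on the compact `K`, hence bounded there
  have hKc : IsCompact (Subtype.val '' K : Set E4) := hK.image continuous_subtype_val
  have hScont : ContinuousOn S (Subtype.val '' K) := by
    rintro _ ⟨z, hz, rfl⟩
    refine ContinuousAt.continuousWithinAt (tendsto_finsetSum _ fun m _ ↦ ?_)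
    exact (((contDiffAt_extend hsmooth z).continuousAt_iteratedFDeriv (k := m)
      (by exact_mod_cast le_top)).norm.pow 2)
  obtain ⟨B, hB⟩ := hKc.exists_bound_of_continuousOn hScont
  obtain ⟨ρ, -, hρ⟩ := exists_spatialNorm_le_of_isCompact hK
  -- `S` vanishes at data-free slice points
  have hSzero : ∀ x : Kerr.region a (Kerr.rPlus M a), (x : E4) 0 = 0 → x ∉ K → S x = 0 := by
    intro x hx0 hxK
    rw [hS]
    refine Finset.sum_eq_zero fun m _ ↦ ?_
    rw [hΦ, Kerr.iteratedFDeriv_extend_eq_zero_of_data hM a _ hsmooth hsol hK hdata hx0 hxK m,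
      norm_zero]
    norm_num
  -- pointwise bound of the integrand
  have hpt : ∀ y : E3,
      {y : E3 | E4.ofTimeSpace 0 y ∈ Kerr.exterior M a}.indicator
          (fun y ↦ ENNReal.ofReal ((1 + ‖y‖) ^ (0 : ℝ) * S (E4.ofTimeSpace 0 y))) y ≤
        (Metric.closedBall (0 : E3) ρ).indicator (fun _ ↦ ENNReal.ofReal B) y := by
    intro y
    by_cases hmem : E4.ofTimeSpace 0 y ∈ Kerr.exterior M a
    · rw [indicator_of_mem (show y ∈ {y : E3 | E4.ofTimeSpace 0 y ∈ Kerr.exterior M a} from hmem),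
        Real.rpow_zero, one_mul]
      set x : Kerr.region a (Kerr.rPlus M a) := ⟨E4.ofTimeSpace 0 y, hmem⟩ with hx
      by_cases hxK : x ∈ K
      · have hyρ : y ∈ Metric.closedBall (0 : E3) ρ := by
          rw [Metric.mem_closedBall, dist_zero_right, ← E4.spatialNorm_ofTimeSpace 0 y]
          exact hρ x hxK
        rw [indicator_of_mem hyρ]
        refine ENNReal.ofReal_le_ofReal ((le_abs_self _).trans ?_)
        have := hB _ ⟨x, hxK, rfl⟩
        rwa [Real.norm_eq_abs] at this
      · rw [hSzero x (by simp [hx]) hxK, ENNReal.ofReal_zero]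
        exact zero_le
    · rw [indicator_of_notMem
        (show y ∉ {y : E3 | E4.ofTimeSpace 0 y ∈ Kerr.exterior M a} from hmem)]
      exact zero_le
  calc sliceSobolevEnergy (Kerr.exterior M a) ψ 0 k 0 univ
      ≤ ∫⁻ y in univ, (Metric.closedBall (0 : E3) ρ).indicator (fun _ ↦ ENNReal.ofReal B) y :=
        lintegral_mono hpt
    _ ≤ ENNReal.ofReal B * volume (Metric.closedBall (0 : E3) ρ) := by
        rw [Measure.restrict_univ]
        exact lintegral_indicator_const_le _ _
    _ < ⊤ := ENNReal.mul_lt_top ENNReal.ofReal_lt_top measure_closedBall_lt_top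

end Literature.Geometry.Lorentzian

end
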